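import Literature.MathematicalPhysics.QuantumFieldTheory.Balaban1983to89.B12Eq213CouplingDependence

/-!
# `Balaban1983to89.B12Eq213SecondOrderCoupling` — T. Bałaban, *Renormalization group approach to lattice gauge field theories. I*,
Commun. Math. Phys. **109** (1987) 249–301 [Balaban1987RG1], (2.13) p. 268 with p. 263 ll. 22–28 (*«a C^∞-function of g_{j−1}»*) and
p. 264 (*«uniformly bounded on this interval together with all derivatives»*): **the new term of (2.13) is C² in the last coupling ON THE
BODY, with the VARIANCE FORMULA `∂²_g 𝐄^{(k+1)} = ⟨∂²_g F⟩ + ⟨(∂_g F)²⟩ − ⟨∂_g F⟩²` (tilted expectations, `F = 𝐏^{(k)} + {…}`) and the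
bound `|∂²_g 𝐄^{(k+1)}| ≤ L₂ + 2L₁²` — the C^{1,1} ∕ second-order letter the node's knits display, kernel-checked on the body**

statement-level skeleton of published theorems with citation tags; proofs where landed; nothing here is a claim about
the Yang–Mills mass gap

PDF held: `paper:balaban1987-cmp109-rg-i-small-field` (journal page = PDF page + 248); pp. 263–264, 268 re-read this session.

CITATION HEADER / WHAT IS REPRODUCED (cell `pub-ymgap`, HUMAN RULING D-0062 Track A, seat `pub-ymgap-dag-n22-b` = the
FIRST-MISSING-ESTIMATE seat of DAG node N22 = NE9; tenth module of the body-level chain (second order of p. 263's clause; first order =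
`B12Eq213CouplingDependence` §2b∕§5, analytic = `B12Eq213AnalyticCoupling`); a NEW LEAF over `B12Eq213CouplingDependence` (p409146 ∕ v1.1
p409833: `hasDerivAt_integral`), nothing there modified).

THE PRINT.  p. 263 ll. 22–28: *«It is a C^∞-function of g_{j−1} ∈ [0, γ], (or analytic)»*; p. 264 (about β): *«uniformly bounded on this
interval together with all derivatives»*; (2.13) p. 268.  NOTHING quantitative printed; the n22-a knits display a C^{1,1} letter for each
young-coupling section ((R)∕(R₂) of `Summits/…/BalabanUVNodesN22Knit`), which at body level is what this module bounds.

WHAT THIS MODULE DOES (THEOREMS ONLY; no definition, no named fact).  For the BODY `D : FluctData X` at `U`, with first and second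
`g`-derivatives `e′`, `e″` of the exponent on a coupling ball around `g₀` for every `B` in the support of `χ_U`, UNIFORMLY bounded there by
`L₁`, `L₂` (the simple currency; the Gaussian currency would dominate by quadratic forms as in v1.1 of module 1), measurability and
integrability at `g₀`:
* `hasDerivAt_firstMoment` — `g ↦ ∫ χ_U e^{F} e′ dμ_U` has derivative `∫ χ_U e^{F}(e″ + e′²) dμ_U` at `g₀` (dominated differentiation);
* **`hasDerivAt_derivNewTerm`** — the first derivative `g ↦ (∫χe^{F})⁻¹∫χe^{F}e′` (the value of `∂_g 𝐄^{(k+1)}` from module 1) has derivative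
  `⟨e″ + e′²⟩ − ⟨e′⟩²` at `g₀` (quotient rule): THE VARIANCE FORMULA;
* **`abs_secondDeriv_newTerm_le`** — `|⟨e″ + e′²⟩ − ⟨e′⟩²| ≤ L₂ + 2L₁²`; **`abs_derivNewTerm_sub_le`** — on a coupling ball where the hypotheses
  hold, the first derivative is `(L₂ + 2L₁²)`-Lipschitz (mean value theorem): the C^{1,1} letter.
HONEST READING: body-level; the uniform bounds `L₁`, `L₂` on the small-field support are displayed (for Bałaban's exponent they come from
(2.12)'s explicit `𝐏^{(k)}` and (1.17) ∘ the substitution, modules `B12ZeroCoupling268` ∕ `B12Eq212BracketCoupling`); localization absent.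

v1.1 (APPEND-ONLY, same seat; §§1–3 byte-identical): §4 the DOMINATED currency — `hasDerivAt_firstMoment_of_dominated`,
**`hasDerivAt_derivNewTerm_of_dominated`** (the variance formula under integrable dominations of `χ_U e^{F}e′`, `χ_U e^{F}(e″ + e′²)`),
`abs_secondDeriv_le_tilted` (`|⟨e″ + e′²⟩ − ⟨e′⟩²| ≤ ⟨w₂⟩ + ⟨w₁⟩²` for majorants on the support) — consumed by `B12Eq213GaussianSecondOrder`.

v1.2 (APPEND-ONLY, seat gen 2; §§1–4 byte-identical): §5 the SECOND-DIFFERENCE letter from the C^{1,1} letter (Taylor at second order in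
difference form, no second derivative needed): `|f(t+d) − 2f(t) + f(t−d)| ≤ K·d²` whenever `f′` is `K`-Lipschitz between `t − d` and `t + d`;
hence on a coupling ball carrying §3's hypotheses **`abs_secondDiff_newTerm_le_of_ball`** (`|Δ²_d 𝐄^{(k+1)}(·, U)| ≤ (L₂ + 2L₁²)·d²`) and, with a
history-free remainder `R` whose derivative is `K_R`-Lipschitz, **`abs_secondDiff_newTerm_add_le_of_ball`** (`≤ (L₂ + 2L₁² + K_R)·d²`) — literally
the birth-step letter (B2) `hB2` displayed by the node's knit `Summits/…/BalabanUVNodesN22KnitBodyTower.abs_secondDiff_action_le_linear_of_shapes`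
(cell bus: dag-ref-B READ-218, «(B2) supplied by nobody yet»), at body level from exponent-level letters.

HONEST FRAMING: count-neutral Track-A side module; NOT a discharge of node N22; one finite T⁴ programme at fixed ε, Bałaban AS PRINTED with
locators; nothing continuum ∕ ℝ⁴ ∕ OS ∕ mass-gap ∕ Clay.
-/

noncomputable section

namespace Literature.MathematicalPhysics.QuantumFieldTheory.Balaban1983to89.B12Eq213SecondOrderCoupling

open _root_.MeasureTheory
open scoped BigOperators
open Literature.MathematicalPhysics.QuantumFieldTheory.Balaban1983to89
open Literature.MathematicalPhysics.QuantumFieldTheory.Balaban1983to89.B12Eq213Body268 (FluctData)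
open Literature.MathematicalPhysics.QuantumFieldTheory.Balaban1983to89.B12Eq213CouplingDependence

variable {X : Type*} (D : FluctData X)

/-- **THE FIRST MOMENT IS DIFFERENTIABLE**: with `e′`, `e″` the first two `g`-derivatives of the exponent on the coupling ball
`|g − g₀| < ε` for every `B` in the support of `χ_U`, uniformly bounded by `L₁`, `L₂` there, the integrands measurable near `g₀` and
integrable at `g₀`, `g ↦ ∫ χ_U e^{F(g)} e′(g) dμ_U` has derivative `∫ χ_U e^{F(g₀)} (e″(g₀) + e′(g₀)²) dμ_U` at `g₀`.
[cite: Balaban1987RG1, (2.13) p.268 and p.263 (clause before (1.18))] -/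
theorem hasDerivAt_firstMoment {U : X} {g₀ ε L₁ L₂ : ℝ} (e' e'' : ℝ → D.𝓑 → ℝ) (hε : 0 < ε)
    (hmeas : ∀ g ∈ Metric.ball g₀ ε, AEStronglyMeasurable (D.integrand g U) (D.μ U))
    (hmeas' : ∀ g ∈ Metric.ball g₀ ε, AEStronglyMeasurable (e' g) (D.μ U))
    (hmeas'' : AEStronglyMeasurable (e'' g₀) (D.μ U))
    (hint : Integrable (D.integrand g₀ U) (D.μ U))
    (hdiff : ∀ B, D.χ U B ≠ 0 → ∀ g ∈ Metric.ball g₀ ε, HasDerivAt (fun g => D.exponent g U B) (e' g B) g)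
    (hdiff' : ∀ B, D.χ U B ≠ 0 → ∀ g ∈ Metric.ball g₀ ε, HasDerivAt (fun g => e' g B) (e'' g B) g)
    (hL₁ : ∀ B, D.χ U B ≠ 0 → ∀ g ∈ Metric.ball g₀ ε, |e' g B| ≤ L₁)
    (hL₂ : ∀ B, D.χ U B ≠ 0 → ∀ g ∈ Metric.ball g₀ ε, |e'' g B| ≤ L₂) :
    HasDerivAt (fun g => ∫ B, D.integrand g U B * e' g B ∂(D.μ U))
      (∫ B, D.integrand g₀ U B * (e'' g₀ B + e' g₀ B ^ 2) ∂(D.μ U)) g₀ := by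
  have hg₀ : g₀ ∈ Metric.ball g₀ ε := Metric.mem_ball_self hε
  -- the exponent is L₁-Lipschitz on the ball along the support
  have hlip : ∀ B, D.χ U B ≠ 0 → ∀ g ∈ Metric.ball g₀ ε, |D.exponent g U B - D.exponent g₀ U B| ≤ L₁ * |g - g₀| := by
    intro B hB g hg
    have h := Convex.norm_image_sub_le_of_norm_hasDerivWithin_le (f := fun g => D.exponent g U B) (f' := fun g => e' g B)
      (s := Metric.ball g₀ ε) (fun x hx => (hdiff B hB x hx).hasDerivWithinAt)
      (fun x hx => by simpa [Real.norm_eq_abs] using hL₁ B hB x hx) (convex_ball g₀ ε) hg₀ hg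
    simpa [Real.norm_eq_abs] using h
  have key := hasDerivAt_integral_of_dominated_loc_of_deriv_le (μ := D.μ U)
    (F := fun g B => D.integrand g U B * e' g B)
    (F' := fun g B => D.integrand g U B * (e'' g B + e' g B ^ 2)) (x₀ := g₀)
    (bound := fun B => (L₂ + L₁ ^ 2) * Real.exp (L₁ * ε) * D.integrand g₀ U B)
    (s := Metric.ball g₀ ε) (Metric.ball_mem_nhds g₀ hε) ?_ ?_ ?_ ?_ ?_ ?_
  · exact key.2
  · exact Filter.eventually_of_mem (Metric.ball_mem_nhds g₀ hε) fun g hg => (hmeas g hg).mul (hmeas' g hg)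
  · refine (hint.const_mul L₁).mono' ((hmeas g₀ hg₀).mul (hmeas' g₀ hg₀)) (Filter.Eventually.of_forall fun B => ?_)
    by_cases hχ : D.χ U B = 0
    · simp [FluctData.integrand_apply, hχ]
    · rw [Real.norm_eq_abs, abs_mul, abs_of_nonneg (D.integrand_nonneg g₀ U B), mul_comm]
      exact mul_le_mul_of_nonneg_right (hL₁ B hχ g₀ hg₀) (D.integrand_nonneg g₀ U B)
  · exact (hint.aestronglyMeasurable).mul (hmeas''.add ((hmeas' g₀ hg₀).pow 2))
  · refine Filter.Eventually.of_forall fun B g hg => ?_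
    by_cases hχ : D.χ U B = 0
    · simp [FluctData.integrand_apply, hχ]
    · have h1 : |e'' g B + e' g B ^ 2| ≤ L₂ + L₁ ^ 2 := by
        have ha := hL₂ B hχ g hg
        have hb := hL₁ B hχ g hg
        have hsq : e' g B ^ 2 ≤ L₁ ^ 2 := by
          rw [← sq_abs]; exact pow_le_pow_left₀ (abs_nonneg _) hb 2
        calc |e'' g B + e' g B ^ 2| ≤ |e'' g B| + |e' g B ^ 2| := abs_add_le _ _
          _ ≤ L₂ + L₁ ^ 2 := add_le_add ha (by rw [abs_of_nonneg (sq_nonneg _)]; exact hsq)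
      have h2 : D.exponent g U B ≤ D.exponent g₀ U B + L₁ * ε := by
        have := (abs_le.1 (hlip B hχ g hg)).2
        have hgε : |g - g₀| ≤ ε := by
          have : dist g g₀ < ε := Metric.mem_ball.1 hg
          rw [Real.dist_eq] at this
          exact this.le
        have hL0 : 0 ≤ L₁ := (abs_nonneg _).trans (hL₁ B hχ g hg)
        nlinarith
      rw [Real.norm_eq_abs, abs_mul, abs_of_nonneg (D.integrand_nonneg g U B), FluctData.integrand_apply,
        FluctData.integrand_apply]
      have hL0 : 0 ≤ L₂ + L₁ ^ 2 := (abs_nonneg _).trans h1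
      calc D.χ U B * Real.exp (D.exponent g U B) * |e'' g B + e' g B ^ 2|
          ≤ D.χ U B * Real.exp (D.exponent g₀ U B + L₁ * ε) * (L₂ + L₁ ^ 2) :=
            mul_le_mul (mul_le_mul_of_nonneg_left (Real.exp_le_exp.2 h2) (D.χ_nonneg U B)) h1 (abs_nonneg _)
              (mul_nonneg (D.χ_nonneg U B) (Real.exp_nonneg _))
        _ = (L₂ + L₁ ^ 2) * Real.exp (L₁ * ε) * (D.χ U B * Real.exp (D.exponent g₀ U B)) := by rw [Real.exp_add]; ring
  · exact hint.const_mul _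
  · refine Filter.Eventually.of_forall fun B g hg => ?_
    by_cases hχ : D.χ U B = 0
    · have e0 : (fun g => D.integrand g U B * e' g B) = fun _ => 0 := by
        funext g; simp [FluctData.integrand_apply, hχ]
      rw [e0]
      simpa [FluctData.integrand_apply, hχ] using hasDerivAt_const g (0 : ℝ)
    · -- d/dg [χ e^{F} e′] = χ e^{F} e′·e′ + χ e^{F} e″
      have hF := ((hdiff B hχ g hg).exp).const_mul (D.χ U B)
      have hprod := hF.mul (hdiff' B hχ g hg)
      have e : D.χ U B * (Real.exp (D.exponent g U B) * e' g B) * e' g B + D.χ U B * Real.exp (D.exponent g U B) * e'' g B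
          = D.integrand g U B * (e'' g B + e' g B ^ 2) := by
        rw [FluctData.integrand_apply]; ring
      have hfun : (fun x => D.integrand x U B * e' x B)
          = ((fun y => D.χ U B * Real.exp (D.exponent y U B)) * fun g => e' g B) := by
        funext y; simp only [Pi.mul_apply, FluctData.integrand_apply]
      rw [hfun, ← e]
      exact hprod

/-- **THE VARIANCE FORMULA — THE NEW TERM IS C² IN THE LAST COUPLING ON THE BODY**: under the hypotheses of `hasDerivAt_firstMoment`
and a positive integral at `g₀`, the first derivative of the new term, `g ↦ (∫ χ_U e^{F})⁻¹ ∫ χ_U e^{F} e′` (its value by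
`B12Eq213CouplingDependence.hasDerivAt_newTerm`), has at `g₀` the derivative `⟨e″ + e′²⟩ − ⟨e′⟩²` (tilted expectations in the small-field
interacting measure): `∂²_g 𝐄^{(k+1)} = ⟨∂²_g F⟩ + Var(∂_g F)`. [cite: Balaban1987RG1, (2.13) p.268 and p.263 (clause before (1.18))] -/
theorem hasDerivAt_derivNewTerm {U : X} {g₀ ε L₁ L₂ : ℝ} (e' e'' : ℝ → D.𝓑 → ℝ) (hε : 0 < ε)
    (hmeas : ∀ g ∈ Metric.ball g₀ ε, AEStronglyMeasurable (D.integrand g U) (D.μ U))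
    (hmeas' : ∀ g ∈ Metric.ball g₀ ε, AEStronglyMeasurable (e' g) (D.μ U))
    (hmeas'' : AEStronglyMeasurable (e'' g₀) (D.μ U))
    (hint : Integrable (D.integrand g₀ U) (D.μ U))
    (hdiff : ∀ B, D.χ U B ≠ 0 → ∀ g ∈ Metric.ball g₀ ε, HasDerivAt (fun g => D.exponent g U B) (e' g B) g)
    (hdiff' : ∀ B, D.χ U B ≠ 0 → ∀ g ∈ Metric.ball g₀ ε, HasDerivAt (fun g => e' g B) (e'' g B) g)
    (hL₁ : ∀ B, D.χ U B ≠ 0 → ∀ g ∈ Metric.ball g₀ ε, |e' g B| ≤ L₁)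
    (hL₂ : ∀ B, D.χ U B ≠ 0 → ∀ g ∈ Metric.ball g₀ ε, |e'' g B| ≤ L₂) (hpos : 0 < D.integral g₀ U) :
    HasDerivAt (fun g => (D.integral g U)⁻¹ * ∫ B, D.integrand g U B * e' g B ∂(D.μ U))
      ((D.integral g₀ U)⁻¹ * ∫ B, D.integrand g₀ U B * (e'' g₀ B + e' g₀ B ^ 2) ∂(D.μ U)
        - ((D.integral g₀ U)⁻¹ * ∫ B, D.integrand g₀ U B * e' g₀ B ∂(D.μ U)) ^ 2) g₀ := by
  have hnum := hasDerivAt_firstMoment D e' e'' hε hmeas hmeas' hmeas'' hint hdiff hdiff' hL₁ hL₂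
  have hden := hasDerivAt_integral D e' hε hmeas hint
    (hmeas' g₀ (Metric.mem_ball_self hε)) hdiff hL₁
  have hq := hnum.div hden hpos.ne'
  have e : (fun g => (D.integral g U)⁻¹ * ∫ B, D.integrand g U B * e' g B ∂(D.μ U))
      = (fun g => ∫ B, D.integrand g U B * e' g B ∂(D.μ U)) / fun g => D.integral g U := by
    funext g; simp only [Pi.div_apply]; rw [div_eq_inv_mul]
  rw [e]
  refine hq.congr_deriv ?_
  have hI0 : D.integral g₀ U ≠ 0 := hpos.ne'
  field_simp

/-- **THE SECOND DERIVATIVE IS BOUNDED BY `L₂ + 2L₁²`**: `|⟨e″ + e′²⟩ − ⟨e′⟩²| ≤ L₂ + 2L₁²` (both tilted expectations are means of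
functions bounded by `L₂ + L₁²` resp. `L₁` on the small-field support; `0 ≤ ⟨e′⟩² ≤ L₁²`; the sharper `L₂ + L₁²` via `⟨e′²⟩ − ⟨e′⟩² ≥ 0`
would need the integrability of the second-moment integrand, not assumed here).  With `hasDerivAt_derivNewTerm` this is the body-level
C^{1,1} letter: the first derivative of `g ↦ 𝐄^{(k+1)}(g, U)` is `(L₂ + 2L₁²)`-Lipschitz where these bounds hold.
[cite: Balaban1987RG1, p.263 (clause before (1.18)) and p.264] -/
theorem abs_secondDeriv_newTerm_le {U : X} {g₀ ε L₁ L₂ : ℝ} (e' e'' : ℝ → D.𝓑 → ℝ) (hε : 0 < ε)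
    (hint : Integrable (D.integrand g₀ U) (D.μ U))
    (hL₁ : ∀ B, D.χ U B ≠ 0 → ∀ g ∈ Metric.ball g₀ ε, |e' g B| ≤ L₁)
    (hL₂ : ∀ B, D.χ U B ≠ 0 → ∀ g ∈ Metric.ball g₀ ε, |e'' g B| ≤ L₂) (hpos : 0 < D.integral g₀ U) :
    |(D.integral g₀ U)⁻¹ * ∫ B, D.integrand g₀ U B * (e'' g₀ B + e' g₀ B ^ 2) ∂(D.μ U)
        - ((D.integral g₀ U)⁻¹ * ∫ B, D.integrand g₀ U B * e' g₀ B ∂(D.μ U)) ^ 2| ≤ L₂ + 2 * L₁ ^ 2 := by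
  have hg₀ : g₀ ∈ Metric.ball g₀ ε := Metric.mem_ball_self hε
  have hI : D.integral g₀ U = ∫ B, D.integrand g₀ U B ∂(D.μ U) := rfl
  -- tilted expectation of a function bounded by M in modulus is bounded by M
  have tilt : ∀ (w : D.𝓑 → ℝ) (M : ℝ), (∀ B, D.χ U B ≠ 0 → |w B| ≤ M) →
      |(D.integral g₀ U)⁻¹ * ∫ B, D.integrand g₀ U B * w B ∂(D.μ U)| ≤ M := by
    intro w M hw
    have hnum : |∫ B, D.integrand g₀ U B * w B ∂(D.μ U)| ≤ M * D.integral g₀ U := by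
      rw [hI]
      have h1 : ‖∫ B, D.integrand g₀ U B * w B ∂(D.μ U)‖ ≤ ∫ B, M * D.integrand g₀ U B ∂(D.μ U) := by
        refine norm_integral_le_of_norm_le (hint.const_mul M) (Filter.Eventually.of_forall fun B => ?_)
        by_cases hχ : D.χ U B = 0
        · simp [FluctData.integrand_apply, hχ]
        · rw [Real.norm_eq_abs, abs_mul, abs_of_nonneg (D.integrand_nonneg g₀ U B), mul_comm]
          exact mul_le_mul_of_nonneg_right (hw B hχ) (D.integrand_nonneg g₀ U B)
      rw [integral_const_mul] at h1
      simpa [Real.norm_eq_abs] using h1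
    rw [abs_mul, abs_inv, abs_of_pos hpos]
    calc (D.integral g₀ U)⁻¹ * |∫ B, D.integrand g₀ U B * w B ∂(D.μ U)|
        ≤ (D.integral g₀ U)⁻¹ * (M * D.integral g₀ U) := mul_le_mul_of_nonneg_left hnum (inv_nonneg.2 hpos.le)
      _ = M := by field_simp
  have hA := tilt (fun B => e'' g₀ B + e' g₀ B ^ 2) (L₂ + L₁ ^ 2) (fun B hB => by
    have ha := hL₂ B hB g₀ hg₀
    have hb := hL₁ B hB g₀ hg₀
    have hsq : e' g₀ B ^ 2 ≤ L₁ ^ 2 := by rw [← sq_abs]; exact pow_le_pow_left₀ (abs_nonneg _) hb 2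
    calc |e'' g₀ B + e' g₀ B ^ 2| ≤ |e'' g₀ B| + |e' g₀ B ^ 2| := abs_add_le _ _
      _ ≤ L₂ + L₁ ^ 2 := add_le_add ha (by rw [abs_of_nonneg (sq_nonneg _)]; exact hsq))
  have hB := tilt (fun B => e' g₀ B) L₁ (fun B hB => hL₁ B hB g₀ hg₀)
  set a := (D.integral g₀ U)⁻¹ * ∫ B, D.integrand g₀ U B * (e'' g₀ B + e' g₀ B ^ 2) ∂(D.μ U) with ha_def
  set b := (D.integral g₀ U)⁻¹ * ∫ B, D.integrand g₀ U B * e' g₀ B ∂(D.μ U) with hb_def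
  have hb2 : b ^ 2 ≤ L₁ ^ 2 := by rw [← sq_abs]; exact pow_le_pow_left₀ (abs_nonneg _) hB 2
  have hA' := abs_le.1 hA
  rw [abs_le]
  constructor
  · nlinarith [sq_nonneg b]
  · nlinarith [sq_nonneg b]

/-- **THE C^{1,1} LETTER ON A COUPLING WINDOW**: if the hypotheses of `hasDerivAt_derivNewTerm` hold on a whole coupling ball
`|g − c| < ρ` (first two `g`-derivatives of the exponent on the small-field support bounded by `L₁`, `L₂`; measurability; integrability
and positivity of the (2.13) integral at every coupling of the ball), then the first derivative of the new term,
`g ↦ (∫χe^{F})⁻¹∫χe^{F}e′`, is `(L₂ + 2L₁²)`-LIPSCHITZ on the ball (mean value theorem) — the body-level form of the C^{1,1} letter of a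
young-coupling section. [cite: Balaban1987RG1, p.263 (clause before (1.18)) and p.264] -/
theorem abs_derivNewTerm_sub_le {U : X} {c ρ L₁ L₂ : ℝ} (e' e'' : ℝ → D.𝓑 → ℝ)
    (hmeas : ∀ g ∈ Metric.ball c ρ, AEStronglyMeasurable (D.integrand g U) (D.μ U))
    (hmeas' : ∀ g ∈ Metric.ball c ρ, AEStronglyMeasurable (e' g) (D.μ U))
    (hmeas'' : ∀ g ∈ Metric.ball c ρ, AEStronglyMeasurable (e'' g) (D.μ U))
    (hint : ∀ g ∈ Metric.ball c ρ, Integrable (D.integrand g U) (D.μ U))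
    (hdiff : ∀ B, D.χ U B ≠ 0 → ∀ g ∈ Metric.ball c ρ, HasDerivAt (fun g => D.exponent g U B) (e' g B) g)
    (hdiff' : ∀ B, D.χ U B ≠ 0 → ∀ g ∈ Metric.ball c ρ, HasDerivAt (fun g => e' g B) (e'' g B) g)
    (hL₁ : ∀ B, D.χ U B ≠ 0 → ∀ g ∈ Metric.ball c ρ, |e' g B| ≤ L₁)
    (hL₂ : ∀ B, D.χ U B ≠ 0 → ∀ g ∈ Metric.ball c ρ, |e'' g B| ≤ L₂)
    (hpos : ∀ g ∈ Metric.ball c ρ, 0 < D.integral g U) {g g' : ℝ} (hg : g ∈ Metric.ball c ρ) (hg' : g' ∈ Metric.ball c ρ) :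
    |(D.integral g' U)⁻¹ * ∫ B, D.integrand g' U B * e' g' B ∂(D.μ U)
        - (D.integral g U)⁻¹ * ∫ B, D.integrand g U B * e' g B ∂(D.μ U)| ≤ (L₂ + 2 * L₁ ^ 2) * |g' - g| := by
  -- at every point of the ball: the variance-formula derivative, bounded by L₂ + 2L₁² (from a small ball inside the window)
  have hpt : ∀ g₀ ∈ Metric.ball c ρ, ∃ v : ℝ,
      HasDerivAt (fun g => (D.integral g U)⁻¹ * ∫ B, D.integrand g U B * e' g B ∂(D.μ U)) v g₀ ∧ |v| ≤ L₂ + 2 * L₁ ^ 2 := by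
    intro g₀ hg₀
    have hε : 0 < ρ - dist g₀ c := sub_pos.2 (Metric.mem_ball.1 hg₀)
    have hsub : Metric.ball g₀ (ρ - dist g₀ c) ⊆ Metric.ball c ρ := Metric.ball_subset_ball' (by linarith)
    refine ⟨_, hasDerivAt_derivNewTerm D e' e'' hε (fun g hg => hmeas g (hsub hg)) (fun g hg => hmeas' g (hsub hg))
      (hmeas'' g₀ hg₀) (hint g₀ hg₀) (fun B hB g hg => hdiff B hB g (hsub hg)) (fun B hB g hg => hdiff' B hB g (hsub hg))
      (fun B hB g hg => hL₁ B hB g (hsub hg)) (fun B hB g hg => hL₂ B hB g (hsub hg)) (hpos g₀ hg₀), ?_⟩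
    exact abs_secondDeriv_newTerm_le D e' e'' hε (hint g₀ hg₀) (fun B hB g hg => hL₁ B hB g (hsub hg))
      (fun B hB g hg => hL₂ B hB g (hsub hg)) (hpos g₀ hg₀)
  choose! v hv using hpt
  have key := Convex.norm_image_sub_le_of_norm_hasDerivWithin_le
    (f := fun g => (D.integral g U)⁻¹ * ∫ B, D.integrand g U B * e' g B ∂(D.μ U)) (f' := v) (s := Metric.ball c ρ)
    (fun x hx => (hv x hx).1.hasDerivWithinAt) (fun x hx => by simpa [Real.norm_eq_abs] using (hv x hx).2)
    (convex_ball c ρ) hg hg'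
  simpa [Real.norm_eq_abs] using key

/-! ## §4 (v1.1). Second order in the DOMINATED currency, general datum

The three theorems above ask UNIFORM bounds `L₁`, `L₂` on the support; for Bałaban's exponent the right currency is domination by
quadratic forms (as in `B12Eq213CouplingDependence` §5 at first order).  This section is the dominated twin: dominations of
`χ_U e^{F}e′` and `χ_U e^{F}(e″ + e′²)` by integrable functions on a coupling ball; the Gaussian instance is
`B12Eq213GaussianSecondOrder`. -/

section Dominated

/-- **THE FIRST MOMENT IS DIFFERENTIABLE (DOMINATED CURRENCY)**: with `e′`, `e″` the first two `g`-derivatives of the exponent on the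
coupling ball `|g − g₀| < ε` for every `B` in the support of `χ_U`, an integrable domination `|χ_U e^{F}(e″ + e′²)| ≤ bound` there,
measurability near `g₀` and integrability of `χ_U e^{F}e′` at `g₀`: `g ↦ ∫ χ_U e^{F}e′ dμ_U` has derivative `∫ χ_U e^{F}(e″ + e′²) dμ_U`
at `g₀`. [cite: Balaban1987RG1, (2.13) p.268 and p.263 (clause before (1.18))] -/
theorem hasDerivAt_firstMoment_of_dominated {U : X} {g₀ ε : ℝ} (e' e'' : ℝ → D.𝓑 → ℝ) (bound : D.𝓑 → ℝ) (hε : 0 < ε)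
    (hmeas : ∀ g ∈ Metric.ball g₀ ε, AEStronglyMeasurable (D.integrand g U) (D.μ U))
    (hmeas' : ∀ g ∈ Metric.ball g₀ ε, AEStronglyMeasurable (e' g) (D.μ U))
    (hmeas'' : AEStronglyMeasurable (e'' g₀) (D.μ U))
    (hint1 : Integrable (fun B => D.integrand g₀ U B * e' g₀ B) (D.μ U))
    (hdiff : ∀ B, D.χ U B ≠ 0 → ∀ g ∈ Metric.ball g₀ ε, HasDerivAt (fun g => D.exponent g U B) (e' g B) g)
    (hdiff' : ∀ B, D.χ U B ≠ 0 → ∀ g ∈ Metric.ball g₀ ε, HasDerivAt (fun g => e' g B) (e'' g B) g)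
    (hdom2 : ∀ B, D.χ U B ≠ 0 → ∀ g ∈ Metric.ball g₀ ε, |D.integrand g U B * (e'' g B + e' g B ^ 2)| ≤ bound B)
    (hbound : Integrable bound (D.μ U)) :
    HasDerivAt (fun g => ∫ B, D.integrand g U B * e' g B ∂(D.μ U))
      (∫ B, D.integrand g₀ U B * (e'' g₀ B + e' g₀ B ^ 2) ∂(D.μ U)) g₀ := by
  have hg₀ : g₀ ∈ Metric.ball g₀ ε := Metric.mem_ball_self hε
  have hs : Metric.ball g₀ ε ∈ nhds g₀ := Metric.ball_mem_nhds g₀ hε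
  have key := hasDerivAt_integral_of_dominated_loc_of_deriv_le (μ := D.μ U)
    (F := fun g B => D.integrand g U B * e' g B) (F' := fun g B => D.integrand g U B * (e'' g B + e' g B ^ 2)) (x₀ := g₀)
    (bound := fun B => max (bound B) 0) (s := Metric.ball g₀ ε) hs ?_ hint1 ?_ ?_ hbound.pos_part ?_
  · exact key.2
  · exact Filter.eventually_of_mem hs fun g hg => (hmeas g hg).mul (hmeas' g hg)
  · exact (hmeas g₀ hg₀).mul (hmeas''.add ((hmeas' g₀ hg₀).pow 2))
  · refine Filter.Eventually.of_forall fun B g hg => ?_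
    by_cases hχ : D.χ U B = 0
    · simp [FluctData.integrand_apply, hχ]
    · rw [Real.norm_eq_abs]; exact (hdom2 B hχ g hg).trans (le_max_left _ _)
  · refine Filter.Eventually.of_forall fun B g hg => ?_
    by_cases hχ : D.χ U B = 0
    · have e0 : (fun g => D.integrand g U B * e' g B) = fun _ => 0 := by
        funext g; simp [FluctData.integrand_apply, hχ]
      rw [e0]
      simpa [FluctData.integrand_apply, hχ] using hasDerivAt_const g (0 : ℝ)
    · have hF := ((hdiff B hχ g hg).exp).const_mul (D.χ U B)
      have hprod := hF.mul (hdiff' B hχ g hg)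
      have e : D.χ U B * (Real.exp (D.exponent g U B) * e' g B) * e' g B + D.χ U B * Real.exp (D.exponent g U B) * e'' g B
          = D.integrand g U B * (e'' g B + e' g B ^ 2) := by
        rw [FluctData.integrand_apply]; ring
      have hfun : (fun x => D.integrand x U B * e' x B)
          = ((fun y => D.χ U B * Real.exp (D.exponent y U B)) * fun g => e' g B) := by
        funext y; simp only [Pi.mul_apply, FluctData.integrand_apply]
      rw [hfun, ← e]
      exact hprod

/-- **THE VARIANCE FORMULA (DOMINATED CURRENCY) — `𝐄^{(k+1)}` IS C² IN THE LAST COUPLING ON THE BODY**: under integrable dominations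
of `χ_U e^{F}e′` (by `bound₁`) and of `χ_U e^{F}(e″ + e′²)` (by `bound₂`) on a coupling ball, measurability, integrability of
`χ_U e^{F}` and a positive integral at `g₀`: the first derivative `g ↦ (∫χe^{F})⁻¹∫χe^{F}e′` of the new term (its value by
`B12Eq213CouplingDependence.hasDerivAt_newTerm_of_dominated`) has at `g₀` the derivative `⟨e″ + e′²⟩ − ⟨e′⟩²` (tilted expectations).
[cite: Balaban1987RG1, (2.13) p.268 and p.263 (clause before (1.18))] -/
theorem hasDerivAt_derivNewTerm_of_dominated {U : X} {g₀ ε : ℝ} (e' e'' : ℝ → D.𝓑 → ℝ) (bound₁ bound₂ : D.𝓑 → ℝ) (hε : 0 < ε)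
    (hmeas : ∀ g ∈ Metric.ball g₀ ε, AEStronglyMeasurable (D.integrand g U) (D.μ U))
    (hmeas' : ∀ g ∈ Metric.ball g₀ ε, AEStronglyMeasurable (e' g) (D.μ U))
    (hmeas'' : AEStronglyMeasurable (e'' g₀) (D.μ U))
    (hint : Integrable (D.integrand g₀ U) (D.μ U))
    (hdiff : ∀ B, D.χ U B ≠ 0 → ∀ g ∈ Metric.ball g₀ ε, HasDerivAt (fun g => D.exponent g U B) (e' g B) g)
    (hdiff' : ∀ B, D.χ U B ≠ 0 → ∀ g ∈ Metric.ball g₀ ε, HasDerivAt (fun g => e' g B) (e'' g B) g)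
    (hdom1 : ∀ B, D.χ U B ≠ 0 → ∀ g ∈ Metric.ball g₀ ε, |D.integrand g U B * e' g B| ≤ bound₁ B)
    (hdom2 : ∀ B, D.χ U B ≠ 0 → ∀ g ∈ Metric.ball g₀ ε, |D.integrand g U B * (e'' g B + e' g B ^ 2)| ≤ bound₂ B)
    (hbound₁ : Integrable bound₁ (D.μ U)) (hbound₂ : Integrable bound₂ (D.μ U)) (hpos : 0 < D.integral g₀ U) :
    HasDerivAt (fun g => (D.integral g U)⁻¹ * ∫ B, D.integrand g U B * e' g B ∂(D.μ U))
      ((D.integral g₀ U)⁻¹ * ∫ B, D.integrand g₀ U B * (e'' g₀ B + e' g₀ B ^ 2) ∂(D.μ U)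
        - ((D.integral g₀ U)⁻¹ * ∫ B, D.integrand g₀ U B * e' g₀ B ∂(D.μ U)) ^ 2) g₀ := by
  have hg₀ : g₀ ∈ Metric.ball g₀ ε := Metric.mem_ball_self hε
  -- integrability of the first-moment integrand from its domination
  have hint1 : Integrable (fun B => D.integrand g₀ U B * e' g₀ B) (D.μ U) := by
    refine hbound₁.pos_part.mono' ((hmeas g₀ hg₀).mul (hmeas' g₀ hg₀)) (Filter.Eventually.of_forall fun B => ?_)
    by_cases hχ : D.χ U B = 0
    · simp [FluctData.integrand_apply, hχ]
    · rw [Real.norm_eq_abs]; exact (hdom1 B hχ g₀ hg₀).trans (le_max_left _ _)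
  have hnum := hasDerivAt_firstMoment_of_dominated D e' e'' bound₂ hε hmeas hmeas' hmeas'' hint1 hdiff hdiff' hdom2 hbound₂
  have hden := hasDerivAt_integral_of_dominated D e' bound₁ hε hmeas hint (hmeas' g₀ hg₀) hdiff hdom1 hbound₁
  have hq := hnum.div hden hpos.ne'
  have e : (fun g => (D.integral g U)⁻¹ * ∫ B, D.integrand g U B * e' g B ∂(D.μ U))
      = (fun g => ∫ B, D.integrand g U B * e' g B ∂(D.μ U)) / fun g => D.integral g U := by
    funext g; simp only [Pi.div_apply]; rw [div_eq_inv_mul]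
  rw [e]
  refine hq.congr_deriv ?_
  have hI0 : D.integral g₀ U ≠ 0 := hpos.ne'
  field_simp

/-- **THE SECOND DERIVATIVE BOUNDED BY TILTED MOMENTS**: for majorants `w₁ ≥ |e′(g₀)|` and `w₂ ≥ |e″(g₀) + e′(g₀)²|` on the support of
`χ_U` with integrable tilted products and a positive integral, `|⟨e″ + e′²⟩ − ⟨e′⟩²| ≤ ⟨w₂⟩ + ⟨w₁⟩²` (tilted expectations
`⟨w⟩ = (∫χe^{F})⁻¹∫χe^{F}w`). [cite: Balaban1987RG1, (2.13) p.268 and p.263 (clause before (1.18))] -/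
theorem abs_secondDeriv_le_tilted {U : X} {g₀ : ℝ} (e' e'' : ℝ → D.𝓑 → ℝ) (w₁ w₂ : D.𝓑 → ℝ)
    (hw₁ : ∀ B, D.χ U B ≠ 0 → |e' g₀ B| ≤ w₁ B) (hw₂ : ∀ B, D.χ U B ≠ 0 → |e'' g₀ B + e' g₀ B ^ 2| ≤ w₂ B)
    (hint₁ : Integrable (fun B => D.integrand g₀ U B * w₁ B) (D.μ U))
    (hint₂ : Integrable (fun B => D.integrand g₀ U B * w₂ B) (D.μ U)) (hpos : 0 < D.integral g₀ U) :
    |(D.integral g₀ U)⁻¹ * ∫ B, D.integrand g₀ U B * (e'' g₀ B + e' g₀ B ^ 2) ∂(D.μ U)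
        - ((D.integral g₀ U)⁻¹ * ∫ B, D.integrand g₀ U B * e' g₀ B ∂(D.μ U)) ^ 2|
      ≤ (D.integral g₀ U)⁻¹ * ∫ B, D.integrand g₀ U B * w₂ B ∂(D.μ U)
        + ((D.integral g₀ U)⁻¹ * ∫ B, D.integrand g₀ U B * w₁ B ∂(D.μ U)) ^ 2 := by
  have h1 := abs_deriv_newTerm_le_tilted D e' w₁ hw₁ hint₁ hpos
  have h2 := abs_deriv_newTerm_le_tilted D (fun g B => e'' g B + e' g B ^ 2) w₂ hw₂ hint₂ hpos
  set a := (D.integral g₀ U)⁻¹ * ∫ B, D.integrand g₀ U B * (e'' g₀ B + e' g₀ B ^ 2) ∂(D.μ U)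
  set b := (D.integral g₀ U)⁻¹ * ∫ B, D.integrand g₀ U B * e' g₀ B ∂(D.μ U)
  set A := (D.integral g₀ U)⁻¹ * ∫ B, D.integrand g₀ U B * w₂ B ∂(D.μ U)
  set C := (D.integral g₀ U)⁻¹ * ∫ B, D.integrand g₀ U B * w₁ B ∂(D.μ U)
  have hb2 : b ^ 2 ≤ C ^ 2 := by
    rw [← sq_abs b]
    exact pow_le_pow_left₀ (abs_nonneg _) h1 2
  calc |a - b ^ 2| ≤ |a| + |b ^ 2| := abs_sub _ _
    _ ≤ A + C ^ 2 := add_le_add h2 (by rw [abs_of_nonneg (sq_nonneg _)]; exact hb2)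

end Dominated

/-! ## §5 (v1.2). The second-DIFFERENCE letter (B2) from the C^{1,1} letter -/

section SecondDifference

/-- **TAYLOR AT SECOND ORDER, DIFFERENCE FORM**: if `f` has the derivative `f′ x` at every point `x` of a convex `S ∋ t − d, t + d`
(`0 ≤ d`) and `f′` is `K`-Lipschitz on `S`, then `|f(t + d) − 2f(t) + f(t − d)| ≤ K·d²` — mean value on `s ↦ f(t + s) − f(t − d + s)`,
`s ∈ [0, d]`, whose derivative `f′(t + s) − f′(t − d + s)` is at most `K·d`. [folklore] -/
private theorem abs_secondDiff_le_of_lipschitz_deriv {f f' : ℝ → ℝ} {S : Set ℝ} {K t d : ℝ} (hS : Convex ℝ S) (hd : 0 ≤ d)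
    (htm : t - d ∈ S) (htp : t + d ∈ S) (hf : ∀ x ∈ S, HasDerivAt f (f' x) x)
    (hK : ∀ x ∈ S, ∀ y ∈ S, |f' x - f' y| ≤ K * |x - y|) :
    |f (t + d) - 2 * f t + f (t - d)| ≤ K * d ^ 2 := by
  have hseg : Set.Icc (t - d) (t + d) ⊆ S := (convex_iff_ordConnected.1 hS).out htm htp
  have hφ : ∀ s ∈ Set.Icc (0 : ℝ) d,
      HasDerivWithinAt (fun s => f (t + s) - f (t - d + s)) (f' (t + s) - f' (t - d + s)) (Set.Icc (0 : ℝ) d) s := by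
    intro s hs
    have h1 : HasDerivAt (fun s => f (t + s)) (f' (t + s)) s :=
      HasDerivAt.comp_const_add t s (hf _ (hseg ⟨by linarith [hs.1], by linarith [hs.2]⟩))
    have h2 : HasDerivAt (fun s => f (t - d + s)) (f' (t - d + s)) s :=
      HasDerivAt.comp_const_add (t - d) s (hf _ (hseg ⟨by linarith [hs.1], by linarith [hs.2]⟩))
    exact (h1.sub h2).hasDerivWithinAt
  have hbound : ∀ s ∈ Set.Ico (0 : ℝ) d, ‖f' (t + s) - f' (t - d + s)‖ ≤ K * d := by
    intro s hs
    have h := hK (t + s) (hseg ⟨by linarith [hs.1], by linarith [hs.2]⟩) (t - d + s) (hseg ⟨by linarith [hs.1], by linarith [hs.2]⟩)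
    rw [show t + s - (t - d + s) = d by ring, abs_of_nonneg hd] at h
    rwa [Real.norm_eq_abs]
  have hmv := norm_image_sub_le_of_norm_deriv_le_segment' hφ hbound d (Set.right_mem_Icc.2 hd)
  rw [Real.norm_eq_abs] at hmv
  have e : f (t + d) - f (t - d + d) - (f (t + 0) - f (t - d + 0)) = f (t + d) - 2 * f t + f (t - d) := by
    rw [sub_add_cancel, add_zero, add_zero]; ring
  rw [e] at hmv
  calc |f (t + d) - 2 * f t + f (t - d)| ≤ K * d * (d - 0) := hmv
    _ = K * d ^ 2 := by ring

/-- **THE SECOND-DIFFERENCE LETTER OF THE NEW TERM FROM ITS C^{1,1} LETTER**: on a coupling ball `|g − c| < ρ` carrying the hypotheses of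
`abs_derivNewTerm_sub_le` (first two `g`-derivatives of the exponent of (2.13) on the small-field support bounded by `L₁`, `L₂`;
measurability; integrability and positivity of *«the integral above»* at every coupling of the ball), for `t − d, t + d` in the ball
(`0 ≤ d`): **`|𝐄^{(k+1)}(t + d, U) − 2𝐄^{(k+1)}(t, U) + 𝐄^{(k+1)}(t − d, U)| ≤ (L₂ + 2L₁²)·d²`** — p. 263's *«C^∞»* clause at second order in
DIFFERENCE form (the shape the history towers consume), no second derivative of the new term needed. [cite: Balaban1987RG1, p.263 (clause before (1.18)), p.264 and (2.13) p.268] -/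
theorem abs_secondDiff_newTerm_le_of_ball {U : X} {c ρ L₁ L₂ : ℝ} (e' e'' : ℝ → D.𝓑 → ℝ)
    (hmeas : ∀ g ∈ Metric.ball c ρ, AEStronglyMeasurable (D.integrand g U) (D.μ U))
    (hmeas' : ∀ g ∈ Metric.ball c ρ, AEStronglyMeasurable (e' g) (D.μ U))
    (hmeas'' : ∀ g ∈ Metric.ball c ρ, AEStronglyMeasurable (e'' g) (D.μ U))
    (hint : ∀ g ∈ Metric.ball c ρ, Integrable (D.integrand g U) (D.μ U))
    (hdiff : ∀ B, D.χ U B ≠ 0 → ∀ g ∈ Metric.ball c ρ, HasDerivAt (fun g => D.exponent g U B) (e' g B) g)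
    (hdiff' : ∀ B, D.χ U B ≠ 0 → ∀ g ∈ Metric.ball c ρ, HasDerivAt (fun g => e' g B) (e'' g B) g)
    (hL₁ : ∀ B, D.χ U B ≠ 0 → ∀ g ∈ Metric.ball c ρ, |e' g B| ≤ L₁)
    (hL₂ : ∀ B, D.χ U B ≠ 0 → ∀ g ∈ Metric.ball c ρ, |e'' g B| ≤ L₂)
    (hpos : ∀ g ∈ Metric.ball c ρ, 0 < D.integral g U)
    {t d : ℝ} (hd : 0 ≤ d) (htm : t - d ∈ Metric.ball c ρ) (htp : t + d ∈ Metric.ball c ρ) :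
    |D.newTerm (t + d) U - 2 * D.newTerm t U + D.newTerm (t - d) U| ≤ (L₂ + 2 * L₁ ^ 2) * d ^ 2 := by
  -- the new term is differentiable on the ball with derivative the tilted expectation of `e′` (module 1), from a small ball inside
  have hder : ∀ g₀ ∈ Metric.ball c ρ, HasDerivAt (fun g => D.newTerm g U)
      ((D.integral g₀ U)⁻¹ * ∫ B, D.integrand g₀ U B * e' g₀ B ∂(D.μ U)) g₀ := by
    intro g₀ hg₀
    have hε : 0 < ρ - dist g₀ c := sub_pos.2 (Metric.mem_ball.1 hg₀)
    have hsub : Metric.ball g₀ (ρ - dist g₀ c) ⊆ Metric.ball c ρ := Metric.ball_subset_ball' (by linarith)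
    exact hasDerivAt_newTerm D e' hε (fun g hg => hmeas g (hsub hg)) (hint g₀ hg₀) (hmeas' g₀ hg₀)
      (fun B hB g hg => hdiff B hB g (hsub hg)) (fun B hB g hg => hL₁ B hB g (hsub hg)) (hpos g₀ hg₀)
  -- its derivative is `(L₂ + 2L₁²)`-Lipschitz on the ball (§3)
  have hlip : ∀ x ∈ Metric.ball c ρ, ∀ y ∈ Metric.ball c ρ,
      |(D.integral x U)⁻¹ * ∫ B, D.integrand x U B * e' x B ∂(D.μ U)
        - (D.integral y U)⁻¹ * ∫ B, D.integrand y U B * e' y B ∂(D.μ U)| ≤ (L₂ + 2 * L₁ ^ 2) * |x - y| :=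
    fun x hx y hy => abs_derivNewTerm_sub_le D e' e'' hmeas hmeas' hmeas'' hint hdiff hdiff' hL₁ hL₂ hpos hy hx
  exact abs_secondDiff_le_of_lipschitz_deriv (f := fun g => D.newTerm g U)
    (f' := fun g => (D.integral g U)⁻¹ * ∫ B, D.integrand g U B * e' g B ∂(D.μ U)) (convex_ball c ρ) hd htm htp hder hlip

/-- **(B2) — THE BIRTH-STEP SECOND-DIFFERENCE LETTER OF THE HISTORY TOWERS, ON THE BODY**: with, in addition, a history-free remainder
`R` (print's first line and `Z^{(k)}`-bracket of (2.12) as functions of the last coupling) whose derivative `R′` is `K_R`-Lipschitz on the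
ball, `|(𝐄^{(k+1)}(t+d, U) + R(t+d)) − 2(𝐄^{(k+1)}(t, U) + R(t)) + (𝐄^{(k+1)}(t−d, U) + R(t−d))| ≤ (L₂ + 2L₁² + K_R)·d²` — the hypothesis
`hB2` of `Summits/…/BalabanUVNodesN22KnitBodyTower.abs_secondDiff_action_le_linear_of_shapes` read at the step datum
`{D k with Q := 𝐄_k^h ∘ τ k}`. [cite: Balaban1987RG1, p.263 (clause before (1.18)), (2.12)–(2.13) p.268 and §0 (0.23) p.256] -/
theorem abs_secondDiff_newTerm_add_le_of_ball {U : X} {c ρ L₁ L₂ K_R : ℝ} (e' e'' : ℝ → D.𝓑 → ℝ) (R R' : ℝ → ℝ)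
    (hmeas : ∀ g ∈ Metric.ball c ρ, AEStronglyMeasurable (D.integrand g U) (D.μ U))
    (hmeas' : ∀ g ∈ Metric.ball c ρ, AEStronglyMeasurable (e' g) (D.μ U))
    (hmeas'' : ∀ g ∈ Metric.ball c ρ, AEStronglyMeasurable (e'' g) (D.μ U))
    (hint : ∀ g ∈ Metric.ball c ρ, Integrable (D.integrand g U) (D.μ U))
    (hdiff : ∀ B, D.χ U B ≠ 0 → ∀ g ∈ Metric.ball c ρ, HasDerivAt (fun g => D.exponent g U B) (e' g B) g)
    (hdiff' : ∀ B, D.χ U B ≠ 0 → ∀ g ∈ Metric.ball c ρ, HasDerivAt (fun g => e' g B) (e'' g B) g)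
    (hL₁ : ∀ B, D.χ U B ≠ 0 → ∀ g ∈ Metric.ball c ρ, |e' g B| ≤ L₁)
    (hL₂ : ∀ B, D.χ U B ≠ 0 → ∀ g ∈ Metric.ball c ρ, |e'' g B| ≤ L₂)
    (hpos : ∀ g ∈ Metric.ball c ρ, 0 < D.integral g U)
    (hR : ∀ g ∈ Metric.ball c ρ, HasDerivAt R (R' g) g)
    (hRK : ∀ g ∈ Metric.ball c ρ, ∀ g' ∈ Metric.ball c ρ, |R' g - R' g'| ≤ K_R * |g - g'|)
    {t d : ℝ} (hd : 0 ≤ d) (htm : t - d ∈ Metric.ball c ρ) (htp : t + d ∈ Metric.ball c ρ) :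
    |(D.newTerm (t + d) U + R (t + d)) - 2 * (D.newTerm t U + R t) + (D.newTerm (t - d) U + R (t - d))|
      ≤ (L₂ + 2 * L₁ ^ 2 + K_R) * d ^ 2 := by
  have h1 := abs_secondDiff_newTerm_le_of_ball D e' e'' hmeas hmeas' hmeas'' hint hdiff hdiff' hL₁ hL₂ hpos hd htm htp
  have h2 : |R (t + d) - 2 * R t + R (t - d)| ≤ K_R * d ^ 2 :=
    abs_secondDiff_le_of_lipschitz_deriv (convex_ball c ρ) hd htm htp hR hRK
  have e : (D.newTerm (t + d) U + R (t + d)) - 2 * (D.newTerm t U + R t) + (D.newTerm (t - d) U + R (t - d))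
      = (D.newTerm (t + d) U - 2 * D.newTerm t U + D.newTerm (t - d) U) + (R (t + d) - 2 * R t + R (t - d)) := by ring
  rw [e]
  calc |(D.newTerm (t + d) U - 2 * D.newTerm t U + D.newTerm (t - d) U) + (R (t + d) - 2 * R t + R (t - d))|
      ≤ |D.newTerm (t + d) U - 2 * D.newTerm t U + D.newTerm (t - d) U| + |R (t + d) - 2 * R t + R (t - d)| := abs_add_le _ _
    _ ≤ (L₂ + 2 * L₁ ^ 2) * d ^ 2 + K_R * d ^ 2 := add_le_add h1 h2
    _ = (L₂ + 2 * L₁ ^ 2 + K_R) * d ^ 2 := by ring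

end SecondDifference

end Literature.MathematicalPhysics.QuantumFieldTheory.Balaban1983to89.B12Eq213SecondOrderCoupling
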